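import Summits.QuantumFields.YangMills.Theorems.BalabanUVNodesN15SiteScalarLayerDressedSized
import Summits.QuantumFields.YangMills.Theorems.BalabanUVNodesN15FullPropagatorExactSiteSocketWordsF
import HarnessLib

/-!
# Route «BalabanUVNodes», cluster K4 «SpineRates» — node N15 = NE2: THE SITE LAYER WITH THE BACKGROUND LIVE IN THE TwoGrid ENTRY CURRENCY, XVIII — PART XI AT SIZE WITH THE
# AVERAGING SPECIES LIVE: the sized site socket's three letters and `NE2PlusSite` (size LIVE, smallness `M·α₀ ≤ a₀` as printed) from a scalar-site species' three diagonal letters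
# AND an averaging species' six block-local letters, all READ AT SIZE — the `U ≡ 1` layer THE massless scalar site propagator; the bridge the sized `Live` families (parts XII∕XV)
# need to carry the averaging perturbation of (3.58)

Cell `pub-ymgap`, WIDTH SEAT `pub-ymgap-dag-n15-w1` (generation 3; director-ym №197 ∕ HUMAN RULING D-0149; chair R455 (A) ∕ R461; plan g83 `W-SEAT-START-LIST.md` v11 §n15).
`bears_on: R4∕N15 · K3⁷ SpineGivenEndpointR13SepCoPH (stmt-QuantumFields-20544)`.  Filed `--kind proof --supports stmt-QuantumFields-20544 --as helper` — COUNT-NEUTRAL.  THEOREMS ONLY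
(0 `def`, 0 `sorry`).  Imports BY NAME, nothing in the tree modified: this seat's part XI `…N15SiteScalarLayerDressedSized` (`ne2PlusSite_sSiteExOn_of_sizedLetters`; through it parts
VII∕VIII `kingScalarLayer_massless_letters`, dag-n15-c S4 `hasMaj_dressedOp` ∕ `_sub` ∕ `hasMaj_idef_dressedOp`, `bgConst`) and part VI `…N15FullPropagatorExactSiteSocketWordsF`
(`sitePert365F`, `hasMaj_sitePert365F`, `hasMaj_sitePert365F_sub`).

WHY.  Part XI read part IX at size (the sized families' letters are `c₃₅·M·α₀`, smallness `M·α₀ ≤ a₁`) with the averaging species DROPPED; part XIII put the averaging species in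
with UNSIZED letters — consumable only at `M_sz ≡ 1`, where an `NE2PlusSite` conclusion is trivially inhabited as typed (ref-F FLAG-VACUITY-A1; the plan's cure is the sized road).
THIS FILE is the missing corner: part XI's sized bridge WITH part VI's averaging words, so that a size-live (`PairedFamilyGuard.Live`) family can carry the (3.58) averaging
perturbation with a CONCRETE species (part XVII §2's sized letters feed `hF` here; sequel).

CONTENTS.  §1 ★★★ `siteLettersF_of_sizedSpeciesLetters` (part XI §2's proof with part VI's words; threshold `a₁ ∧ a₂ ∧ (2βKc_r + 1)⁻¹`, the species' size `r₀s ≤ r₀a₂` inside the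
`(1 + r)` factors); §2 ★★★ `ne2PlusSite_sSiteExOn_of_sizedSpeciesLettersF` (part XI §1's sized socket ∘ §1).

HONEST FRAMING.  Count-neutral, species-independent BRIDGE; no new estimate; BOTH species are BINDERS here (part XVII inhabits the averaging one at FILE 40's family, parts XII∕XV's
`v1SiteSpecies_letters` the first-order one); the propagator, its dressing and the perturbed matrix `Q′G′²Q′*` are the genuine ∕ model-exact objects of parts VII–IX.  NOT [B9] Thm 3.2 at
a general (3.35)-regular `U` (NE2⁺ NOT PRINTED as an η-rate); Node 00's [B9] layers of record are residual — **N15 is NOT discharged** (typed 28∕28 · discharged 5∕27 of record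
unchanged); K3⁷ OPEN, its N15 pin untouched; one finite four-torus programme at fixed `ε` — NOT ℝ⁴, NOT infinite volume, NOT OS, NOT a mass gap, NOT Clay; R4 closes the conditional
finite-𝕋⁴ rung `BalabanLadder.UV` only.  Restate-immune.
-/

set_option autoImplicit false

noncomputable section

open scoped BigOperators Matrix
open Finset

namespace Summit.QuantumFields.YangMills.BalabanUVNodes.N15.SiteLayerBg

open Literature.MathematicalPhysics.QuantumFieldTheory.Balaban1983to89
open Literature.MathematicalPhysics.QuantumFieldTheory.Balaban1983to89.B11SectG (BlockNorm HasMaj RowSum)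
open Literature.MathematicalPhysics.QuantumFieldTheory.Balaban1983to89.T4EtaRate (PairedInstance EtaPairing NE2PlusSite)
open Literature.MathematicalPhysics.QuantumFieldTheory.Balaban1983to89.T4EtaRateDefect (idef)
open Literature.MathematicalPhysics.QuantumFieldTheory.Balaban1983to89.T4EtaRateCoeffDefect (pull diagK diagK_nonneg diagK_mono fibre)
open Literature.MathematicalPhysics.QuantumFieldTheory.Balaban1983to89.B5Prop11Plancherel (Tor fine)
open Literature.MathematicalPhysics.QuantumFieldTheory.Balaban1983to89.B4Sect5Torus (tdist)
open Literature.MathematicalPhysics.QuantumFieldTheory.Balaban1983to89.B4Sect5Proof (latticeConst latticeConst_nonneg)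
open Literature.MathematicalPhysics.QuantumFieldTheory.Balaban1983to89.B5QGGQ145Bounds (Idx)
open Literature.MathematicalPhysics.QuantumFieldTheory.Balaban1983to89.B6UnitTorusCarrier (unitTorusGeo triangle254_unitTorusGeo rowSum_unitTorusGeo)
open Literature.MathematicalPhysics.QuantumFieldTheory.Balaban1983to89.B9SectDSup (inv_one_sub_le_two)
open Literature.MathematicalPhysics.QuantumFieldTheory.King1986 (aK aK_pos)
open Literature.MathematicalPhysics.QuantumFieldTheory.King1986.Torus (fineOp blockOf tdistT tdistT_nonneg)
open Summit.QuantumFields.YangMills.BalabanUVNodes.N15.VectorPiece (unitTorusGeoS unitTorusGeoS_dist)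
open Summit.QuantumFields.YangMills.BalabanUVNodes.N15.OperatorReadout (opGeo)
open Summit.QuantumFields.YangMills.BalabanUVNodes.N15.BackgroundLayer (blkPair liftPair bgConst bgConst_nonneg)
open Summit.QuantumFields.YangMills.BalabanUVNodes.N15.SiteLayer (siteForm dressedOp hasMaj_dressedOp hasMaj_dressedOp_sub hasMaj_idef_dressedOp)
open Summit.QuantumFields.YangMills.BalabanUVNodes.N15KingModelRung.Curved (kingGOp kingDOp underPtN)

variable {d : ℕ} {L : ℕ} [NeZero L] {I : Type}

/-! ## §1 ★★★ The sockets' sized letters from the two species' letters read at size (averaging species live) -/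

section Arithmetic

/-- The size constant of the full words is linear in the smallness parameter `s` once the species' size `r₀s ≤ R₁` is frozen inside the `(1 + r)` factor. [folklore] -/
theorem sitePertF_sizeConst_le {r₀ s B β ε c R₁ : ℝ} (hr₀ : 0 ≤ r₀) (hs : 0 ≤ s) (hB : 0 ≤ B) (hc : 0 ≤ c) (hR : r₀ * s ≤ R₁) :
    (r₀ * s * (B * B * (1 + r₀ * s)) + B * B * (r₀ * s) + (B + β) * (ε * s)) * c ≤ ((r₀ * (B * B * (1 + R₁)) + B * B * r₀ + (B + β) * ε) * c + 1) * s := by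
  have h1 : (r₀ * s * (B * B * (1 + r₀ * s)) + B * B * (r₀ * s) + (B + β) * (ε * s)) * c
      = ((r₀ * (B * B * (1 + r₀ * s)) + B * B * r₀ + (B + β) * ε) * c) * s := by ring
  rw [h1]
  refine mul_le_mul_of_nonneg_right ?_ hs
  have h2 : r₀ * (B * B * (1 + r₀ * s)) ≤ r₀ * (B * B * (1 + R₁)) :=
    mul_le_mul_of_nonneg_left (mul_le_mul_of_nonneg_left (by linarith) (mul_nonneg hB hB)) hr₀
  nlinarith [mul_le_mul_of_nonneg_right h2 hc]

/-- The two-grid constant of the full words is linear in the rate `θ` once `r₀s ≤ R₁` is frozen. [folklore] -/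
theorem sitePertF_fitConst_le {r₀ s B β c o₀ mX m₀ θ R₁ : ℝ} (hr₀ : 0 ≤ r₀) (hs : 0 ≤ s) (hB : 0 ≤ B) (hc : 0 ≤ c) (ho₀ : 0 ≤ o₀) (hmX : 0 ≤ mX) (hθ : 0 ≤ θ)
    (hR : r₀ * s ≤ R₁) :
    2 * (1 + r₀ * s) * B * c * (B * (o₀ * θ) + mX * θ * (1 + r₀ * s)) + 2 * c * (β * (m₀ * θ))
      ≤ (2 * (1 + R₁) * B * c * (B * o₀ + mX * (1 + R₁)) + 2 * c * (β * m₀) + 1) * θ := by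
  have hrs : 0 ≤ r₀ * s := mul_nonneg hr₀ hs
  have h1r : 1 + r₀ * s ≤ 1 + R₁ := by linarith
  have hab : 2 * (1 + r₀ * s) * B * c ≤ 2 * (1 + R₁) * B * c := by
    have := mul_le_mul_of_nonneg_right h1r (mul_nonneg hB hc); nlinarith
  have hc0 : 0 ≤ B * (o₀ * θ) + mX * θ * (1 + r₀ * s) := by positivity
  have hcd : B * (o₀ * θ) + mX * θ * (1 + r₀ * s) ≤ (B * o₀ + mX * (1 + R₁)) * θ := by
    have : mX * θ * (1 + r₀ * s) ≤ mX * θ * (1 + R₁) := mul_le_mul_of_nonneg_left h1r (mul_nonneg hmX hθ)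
    nlinarith
  have hb0 : 0 ≤ 2 * (1 + R₁) * B * c := by
    have : 0 ≤ 1 + R₁ := by linarith
    positivity
  have hprod := mul_le_mul hab hcd hc0 hb0
  calc 2 * (1 + r₀ * s) * B * c * (B * (o₀ * θ) + mX * θ * (1 + r₀ * s)) + 2 * c * (β * (m₀ * θ))
      ≤ 2 * (1 + R₁) * B * c * ((B * o₀ + mX * (1 + R₁)) * θ) + 2 * c * (β * (m₀ * θ)) := by linarith
    _ = (2 * (1 + R₁) * B * c * (B * o₀ + mX * (1 + R₁)) + 2 * c * (β * m₀)) * θ := by ring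
    _ ≤ (2 * (1 + R₁) * B * c * (B * o₀ + mX * (1 + R₁)) + 2 * c * (β * m₀) + 1) * θ := mul_le_mul_of_nonneg_right (by linarith) hθ

end Arithmetic

section LettersF

variable (Mn : I → Fin (d + 1) → ℕ) [hMn0 : ∀ i μ, NeZero (Mn i μ)] (kk mm : I → ℕ) (Msz : I → ℝ) (Bc Bf : I → B9.Backgrounds)
  (avg : ∀ i, (Bf i).Cfg → (Bc i).Cfg)
  (Vc : ∀ i, (Bc i).Cfg → ((Tor (fine (L ^ kk i) (Mn i)) × Option (Fin (d + 1)) → ℝ) →ₗ[ℝ] (Tor (fine (L ^ kk i) (Mn i)) → ℝ)))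
  (Vf : ∀ i, (Bf i).Cfg → ((Tor (fine (L ^ mm i * L ^ kk i) (Mn i)) × Option (Fin (d + 1)) → ℝ) →ₗ[ℝ] (Tor (fine (L ^ mm i * L ^ kk i) (Mn i)) → ℝ)))
  (Fc : ∀ i, (Bc i).Cfg → (Tor (fine (L ^ kk i) (Mn i)) → ℝ) →ₗ[ℝ] (Tor (Mn i) → ℝ)) (Fsc : ∀ i, (Bc i).Cfg → (Tor (Mn i) → ℝ) →ₗ[ℝ] (Tor (fine (L ^ kk i) (Mn i)) → ℝ))
  (Ff : ∀ i, (Bf i).Cfg → (Tor (fine (L ^ mm i * L ^ kk i) (Mn i)) → ℝ) →ₗ[ℝ] (Tor (Mn i) → ℝ))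
  (Fsf : ∀ i, (Bf i).Cfg → (Tor (Mn i) → ℝ) →ₗ[ℝ] (Tor (fine (L ^ mm i * L ^ kk i) (Mn i)) → ℝ))
set_option maxHeartbeats 400000 in
/-- ★★★ **THE SIZED SITE LETTERS, AVERAGING SPECIES LIVE, FROM THE TWO SPECIES' LETTERS READ AT SIZE** — part XI's `siteLetters_of_sizedSpeciesLetters` with part VI's
averaging words: smallness parameter `s = M_sz i·α₀`; HYPOTHESES `hV` (the first-order species' three diagonal letters `≤ diagK (K s)`, fit `≤ diagK (K s (L^k)^{−γ∕2})`, `s ≤ a₁`) AND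
`hF` (the averaging species' six block-local letters AT SIZE: `Fc(Ū), Fsc(Ū), Ff(U), Fsf(U) ≤ diagK (r₀ s)`, fits `𝔇(Ff(U), Fc(Ū)), 𝔇(Fsf(U), Fsc(Ū)) ≤ diagK (o₀(L^k)^{−γ∕2})`,
`s ≤ a₂`); CONCLUSION = part XI §1's sized `hP` for the FULL (3.65) perturbations `Pf∕Pc := siteEntries (sitePert365F blockOf F Fs G′ (dressedOp G′ D V̂))`, `G′` THE massless scalar
site propagator of the run (parts VII∕VIII), rate exponent `γ∕2`; odd `L ≥ 3`, `a_S > 0`, `0 < γ < 1`, `k i, m i ≥ 1`, `M_sz i ≥ 1`.  Part XI §2's proof with part VI's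
`hasMaj_sitePert365F` ∕ `hasMaj_sitePert365F_sub` in place of part V's words (`r := r₀ s ≤ r₀a₂` inside the `(1 + r)` factors).
[cite: Balaban1985BackgroundPropagators, (3.58) p.402, (3.63)–(3.67) pp.402–403 (mechanism), (3.35) p.396 («|A| < O(1)Mα₀ …»: the letters at size); King1986, Prop. 3.8 (3.71) p.664] -/
theorem siteLettersF_of_sizedSpeciesLetters (hLodd : Odd L) (hL2 : 2 ≤ L) {aS : ℝ} (haS : 0 < aS) (c35 : ℝ) {γ : ℝ} (hγ0 : 0 < γ) (hγ1 : γ < 1)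
    {mT : I → ℕ} (hMnT : ∀ i μ, Mn i μ = 2 * L ^ mT i) (hk : ∀ i, 1 ≤ kk i) (hm : ∀ i, 1 ≤ mm i)
    (hMsz : ∀ i, 1 ≤ Msz i)
    (hV : ∃ K a₁ : ℝ, 0 ≤ K ∧ 0 < a₁ ∧ ∀ (i : I) (α₀ : ℝ), 0 < α₀ → Msz i * α₀ ≤ a₁ → ∀ U : (Bf i).Cfg, (Bf i).Reg335 c35 α₀ U →
      HasMaj (BlockNorm.ofBlocks (unitTorusGeoS L (kk i) (Mn i) (Msz i)) (blkPair (blockOf (L ^ kk i) (Mn i))))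
        (BlockNorm.ofBlocks (unitTorusGeoS L (kk i) (Mn i) (Msz i)) (blockOf (L ^ kk i) (Mn i))) (Vc i (avg i U)) (diagK fun _ => K * (Msz i * α₀)) ∧
      HasMaj (BlockNorm.ofBlocks (unitTorusGeoS L (kk i) (Mn i) (Msz i)) (blkPair (blockOf (L ^ kk i) (Mn i) ∘ underPtN L (kk i) (mm i) (Mn i))))
        (BlockNorm.ofBlocks (unitTorusGeoS L (kk i) (Mn i) (Msz i)) (blockOf (L ^ kk i) (Mn i) ∘ underPtN L (kk i) (mm i) (Mn i))) (Vf i U) (diagK fun _ => K * (Msz i * α₀)) ∧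
      HasMaj (BlockNorm.ofBlocks (unitTorusGeoS L (kk i) (Mn i) (Msz i)) (blkPair (blockOf (L ^ kk i) (Mn i))))
        (BlockNorm.ofBlocks (unitTorusGeoS L (kk i) (Mn i) (Msz i)) (blockOf (L ^ kk i) (Mn i) ∘ underPtN L (kk i) (mm i) (Mn i)))
        (idef (pull (liftPair (underPtN L (kk i) (mm i) (Mn i)))) (pull (underPtN L (kk i) (mm i) (Mn i))) (Vf i U) (Vc i (avg i U)))
        (diagK fun _ => K * (Msz i * α₀) * ((L : ℝ) ^ kk i) ^ (-(γ / 2))))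
    (hF : ∃ r₀ o₀ a₂ : ℝ, 0 ≤ r₀ ∧ 0 ≤ o₀ ∧ 0 < a₂ ∧ ∀ (i : I) (α₀ : ℝ), 0 < α₀ → Msz i * α₀ ≤ a₂ → ∀ U : (Bf i).Cfg, (Bf i).Reg335 c35 α₀ U →
      HasMaj (BlockNorm.ofBlocks (unitTorusGeoS L (kk i) (Mn i) (Msz i)) (blockOf (L ^ kk i) (Mn i))) (BlockNorm.ofBlocks (unitTorusGeoS L (kk i) (Mn i) (Msz i)) (fun y : Tor (Mn i) => y))
        (Fc i (avg i U)) (diagK fun _ => r₀ * (Msz i * α₀)) ∧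
      HasMaj (BlockNorm.ofBlocks (unitTorusGeoS L (kk i) (Mn i) (Msz i)) (fun y : Tor (Mn i) => y)) (BlockNorm.ofBlocks (unitTorusGeoS L (kk i) (Mn i) (Msz i)) (blockOf (L ^ kk i) (Mn i)))
        (Fsc i (avg i U)) (diagK fun _ => r₀ * (Msz i * α₀)) ∧
      HasMaj (BlockNorm.ofBlocks (unitTorusGeoS L (kk i) (Mn i) (Msz i)) (blockOf (L ^ kk i) (Mn i) ∘ underPtN L (kk i) (mm i) (Mn i)))
        (BlockNorm.ofBlocks (unitTorusGeoS L (kk i) (Mn i) (Msz i)) (fun y : Tor (Mn i) => y)) (Ff i U) (diagK fun _ => r₀ * (Msz i * α₀)) ∧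
      HasMaj (BlockNorm.ofBlocks (unitTorusGeoS L (kk i) (Mn i) (Msz i)) (fun y : Tor (Mn i) => y))
        (BlockNorm.ofBlocks (unitTorusGeoS L (kk i) (Mn i) (Msz i)) (blockOf (L ^ kk i) (Mn i) ∘ underPtN L (kk i) (mm i) (Mn i))) (Fsf i U) (diagK fun _ => r₀ * (Msz i * α₀)) ∧
      HasMaj (BlockNorm.ofBlocks (unitTorusGeoS L (kk i) (Mn i) (Msz i)) (blockOf (L ^ kk i) (Mn i))) (BlockNorm.ofBlocks (unitTorusGeoS L (kk i) (Mn i) (Msz i)) (fun y : Tor (Mn i) => y))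
        (idef (pull (underPtN L (kk i) (mm i) (Mn i))) LinearMap.id (Ff i U) (Fc i (avg i U))) (diagK fun _ => o₀ * ((L : ℝ) ^ kk i) ^ (-(γ / 2))) ∧
      HasMaj (BlockNorm.ofBlocks (unitTorusGeoS L (kk i) (Mn i) (Msz i)) (fun y : Tor (Mn i) => y))
        (BlockNorm.ofBlocks (unitTorusGeoS L (kk i) (Mn i) (Msz i)) (blockOf (L ^ kk i) (Mn i) ∘ underPtN L (kk i) (mm i) (Mn i)))
        (idef LinearMap.id (pull (underPtN L (kk i) (mm i) (Mn i))) (Fsf i U) (Fsc i (avg i U))) (diagK fun _ => o₀ * ((L : ℝ) ^ kk i) ^ (-(γ / 2)))) :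
    ∃ δP ζ τ a₁ : ℝ, 0 < δP ∧ 0 < ζ ∧ 0 < τ ∧ 0 < a₁ ∧
      ∀ (i : I) (α₀ : ℝ), 0 < α₀ → Msz i * α₀ ≤ a₁ → ∀ U : (Bf i).Cfg, (Bf i).Reg335 c35 α₀ U →
        (∀ p p' : Idx (Mn i), |siteEntries (Mn i) (sitePert365F (Mn i) (blockOf (L ^ kk i) (Mn i)) (Fc i (avg i U)) (Fsc i (avg i U)) (kingGOp L aS 0 (kk i) (L ^ kk i) (Mn i))
            (dressedOp (kingGOp L aS 0 (kk i) (L ^ kk i) (Mn i)) (fun μ => kingDOp L aS 0 (kk i) (L ^ kk i) (Mn i) μ) (Vc i (avg i U)))) p p'|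
            ≤ ζ * (Msz i * α₀) * Real.exp (-(δP * tdist (Mn i) p p'))) ∧
        (∀ p p' : Idx (Mn i), |siteEntries (Mn i) (sitePert365F (Mn i) (blockOf (L ^ kk i) (Mn i) ∘ underPtN L (kk i) (mm i) (Mn i)) (Ff i U) (Fsf i U)
            (kingGOp L aS 0 (kk i + mm i) (L ^ mm i * L ^ kk i) (Mn i))
            (dressedOp (kingGOp L aS 0 (kk i + mm i) (L ^ mm i * L ^ kk i) (Mn i)) (fun μ => kingDOp L aS 0 (kk i + mm i) (L ^ mm i * L ^ kk i) (Mn i) μ) (Vf i U))) p p'|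
            ≤ ζ * (Msz i * α₀) * Real.exp (-(δP * tdist (Mn i) p p'))) ∧
        (∀ p p' : Idx (Mn i), |siteEntries (Mn i) (sitePert365F (Mn i) (blockOf (L ^ kk i) (Mn i) ∘ underPtN L (kk i) (mm i) (Mn i)) (Ff i U) (Fsf i U)
              (kingGOp L aS 0 (kk i + mm i) (L ^ mm i * L ^ kk i) (Mn i))
              (dressedOp (kingGOp L aS 0 (kk i + mm i) (L ^ mm i * L ^ kk i) (Mn i)) (fun μ => kingDOp L aS 0 (kk i + mm i) (L ^ mm i * L ^ kk i) (Mn i) μ) (Vf i U))) p p'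
            - siteEntries (Mn i) (sitePert365F (Mn i) (blockOf (L ^ kk i) (Mn i)) (Fc i (avg i U)) (Fsc i (avg i U)) (kingGOp L aS 0 (kk i) (L ^ kk i) (Mn i))
              (dressedOp (kingGOp L aS 0 (kk i) (L ^ kk i) (Mn i)) (fun μ => kingDOp L aS 0 (kk i) (L ^ kk i) (Mn i) μ) (Vc i (avg i U)))) p p'|
            ≤ τ * ((L : ℝ) ^ kk i) ^ (-(γ / 2)) * Real.exp (-(δP * tdist (Mn i) p p'))) := by
  obtain ⟨β, δ, m₀, hβ, hδ, hm₀, HU⟩ := kingScalarLayer_massless_letters (d := d) L hLodd hL2 haS hγ0.le hγ1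
  obtain ⟨K, a₁, hK, ha₁, HV⟩ := hV
  obtain ⟨r₀, o₀, a₂, hr₀, ho₀, ha₂, HFs⟩ := hF
  have hLr : (0 : ℝ) ≤ (L : ℝ) := Nat.cast_nonneg _
  -- the Combes–Thomas row sum at `σ = δ∕2`, the threshold on `s = M_sz·α₀`
  set cr : ℝ := latticeConst (d + 1) (δ / 2) with hcr_def
  have hcr : 0 ≤ cr := latticeConst_nonneg _ (by positivity)
  set a₁' : ℝ := min (min a₁ a₂) (1 / (2 * β * K * cr + 1)) with ha₁'_def
  have hden : 0 < 2 * β * K * cr + 1 := by positivity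
  have ha₁' : 0 < a₁' := lt_min (lt_min ha₁ ha₂) (by positivity)
  have ha₁'a₁ : a₁' ≤ a₁ := (min_le_left _ _).trans (min_le_left _ _)
  have ha₁'a₂ : a₁' ≤ a₂ := (min_le_left _ _).trans (min_le_right _ _)
  have hguard : β * (K * a₁') * cr ≤ 1 / 2 := by
    have h1 : a₁' ≤ 1 / (2 * β * K * cr + 1) := min_le_right _ _
    have h2 : β * K * cr * a₁' ≤ β * K * cr * (1 / (2 * β * K * cr + 1)) := mul_le_mul_of_nonneg_left h1 (by positivity)
    have h3 : β * K * cr * (1 / (2 * β * K * cr + 1)) ≤ 1 / 2 := by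
      rw [mul_one_div, div_le_iff₀ hden]; nlinarith [mul_nonneg (mul_nonneg hβ.le hK) hcr]
    nlinarith
  -- the output constants (part V's `(δ∕2, (B+β)εc + 1, 2c(Bm + βm₀) + 1)` at `B = 2β`, `ε = 2β²Kc_r + 1`, `m = bgConst(…, a₁′)`, inner rate `δ∕2`)
  obtain ⟨B, hBdef⟩ : ∃ B : ℝ, B = 2 * β := ⟨_, rfl⟩
  obtain ⟨ε, hεdef⟩ : ∃ ε : ℝ, ε = 2 * β ^ 2 * K * cr + 1 := ⟨_, rfl⟩
  obtain ⟨mX, hmXdef⟩ : ∃ mX : ℝ, mX = bgConst β cr m₀ K a₁' := ⟨_, rfl⟩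
  have hB0 : 0 ≤ B := by rw [hBdef]; positivity
  have hε0 : 0 < ε := by rw [hεdef]; positivity
  have hmX0 : 0 ≤ mX := by rw [hmXdef]; exact bgConst_nonneg hβ.le hcr hm₀.le hK ha₁'.le
  obtain ⟨c2, hc2def⟩ : ∃ c2 : ℝ, c2 = latticeConst (d + 1) (δ / 2 / 2) := ⟨_, rfl⟩
  have hc2 : 0 ≤ c2 := by rw [hc2def]; exact latticeConst_nonneg _ (by positivity)
  -- the species' size `r = r₀ s ≤ r₀ a₂ =: R₁` enters the words through `(1 + r)`
  obtain ⟨R₁, hR₁def⟩ : ∃ R₁ : ℝ, R₁ = r₀ * a₂ := ⟨_, rfl⟩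
  have hR₁ : 0 ≤ R₁ := by rw [hR₁def]; positivity
  refine ⟨δ / 2 / 2, (r₀ * (B * B * (1 + R₁)) + B * B * r₀ + (B + β) * ε) * c2 + 1,
    2 * (1 + R₁) * B * c2 * (B * o₀ + mX * (1 + R₁)) + 2 * c2 * (β * m₀) + 1, a₁', by positivity, by positivity, by positivity, ha₁', fun i α₀ hα₀ hsa U hreg => ?_⟩
  obtain ⟨hG, hD, hG', hD', hDG, hDD⟩ := HU (kk i) (hk i) (mm i) (hm i) (mT i) (Mn i) (hMnT i) (Msz i)
  -- the smallness parameter of the index `s = M_sz i·α₀` (kept syntactic)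
  have hs0 : 0 < Msz i * α₀ := mul_pos (lt_of_lt_of_le one_pos (hMsz i)) hα₀
  have hsa₁ : Msz i * α₀ ≤ a₁ := hsa.trans ha₁'a₁
  have hsa₂ : Msz i * α₀ ≤ a₂ := hsa.trans ha₁'a₂
  -- carrier facts
  have htri := triangle254_unitTorusGeo L (kk i) (Mn i)
  have hrow := rowSum_unitTorusGeo L (kk i) (Mn i) (half_pos hδ)
  have hd : ∀ a b : (unitTorusGeoS L (kk i) (Mn i) (Msz i)).Site, 0 ≤ (unitTorusGeoS L (kk i) (Mn i) (Msz i)).dist a b := fun a b => tdistT_nonneg (Mn i) a b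
  have hθ : 0 ≤ ((L : ℝ) ^ kk i) ^ (-(γ / 2)) := Real.rpow_nonneg (pow_nonneg hLr _) _
  obtain ⟨N, hN, hfibi⟩ := card_fibre_underPtN_ne (L := L) (kk i) (mm i) (Mn i)
  -- the species letters at `R = K·s`; the averaging species' letters at `r = r₀·s`, `o = o₀·θ`
  obtain ⟨hVc, hVf, hDV⟩ := HV i α₀ hα₀ hsa₁ U hreg
  obtain ⟨hF1, hF2, hF3, hF4, hF5, hF6⟩ := HFs i α₀ hα₀ hsa₂ U hreg
  have hr : 0 ≤ r₀ * (Msz i * α₀) := mul_nonneg hr₀ hs0.le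
  have hrR : r₀ * (Msz i * α₀) ≤ R₁ := by rw [hR₁def]; exact mul_le_mul_of_nonneg_left hsa₂ hr₀
  have hR : 0 ≤ K * (Msz i * α₀) := mul_nonneg hK hs0.le
  have hq : β * (K * (Msz i * α₀)) * cr ≤ 1 / 2 := (mul_le_mul_of_nonneg_right (mul_le_mul_of_nonneg_left (mul_le_mul_of_nonneg_left hsa hK) hβ.le) hcr).trans hguard
  have hq1 : β * (K * (Msz i * α₀)) * cr < 1 := by linarith
  have hinv : (1 - β * (K * (Msz i * α₀)) * cr)⁻¹ ≤ 2 := inv_one_sub_le_two hq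
  have hinv0 : 0 ≤ (1 - β * (K * (Msz i * α₀)) * cr)⁻¹ := inv_nonneg.2 (by linarith)
  have hρδ : δ / 2 + δ / 2 ≤ δ := by linarith
  -- S4's three dressing theorems, coarse and fine
  have hXc := hasMaj_dressedOp (g := unitTorusGeoS L (kk i) (Mn i) (Msz i)) (blockOf (L ^ kk i) (Mn i)) htri hd hrow (by positivity) (by positivity : (0 : ℝ) ≤ δ / 2) hρδ
    hβ.le hR hG hD hVc hq1
  have hXf := hasMaj_dressedOp (g := unitTorusGeoS L (kk i) (Mn i) (Msz i)) (blockOf (L ^ kk i) (Mn i) ∘ underPtN L (kk i) (mm i) (Mn i)) htri hd hrow (by positivity)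
    (by positivity : (0 : ℝ) ≤ δ / 2) hρδ hβ.le hR hG' hD' hVf hq1
  have hEc := hasMaj_dressedOp_sub (g := unitTorusGeoS L (kk i) (Mn i) (Msz i)) (blockOf (L ^ kk i) (Mn i)) htri hd hrow (by positivity) (by positivity : (0 : ℝ) ≤ δ / 2) hρδ
    hβ.le hR hG hD hVc hq1
  have hEf := hasMaj_dressedOp_sub (g := unitTorusGeoS L (kk i) (Mn i) (Msz i)) (blockOf (L ^ kk i) (Mn i) ∘ underPtN L (kk i) (mm i) (Mn i)) htri hd hrow (by positivity)
    (by positivity : (0 : ℝ) ≤ δ / 2) hρδ hβ.le hR hG' hD' hVf hq1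
  have hDX := hasMaj_idef_dressedOp (g := unitTorusGeoS L (kk i) (Mn i) (Msz i)) (blockOf (L ^ kk i) (Mn i)) (underPtN L (kk i) (mm i) (Mn i)) htri hd hrow (by positivity) hcr
    (K := K) (a₀ := Msz i * α₀) (by linarith : δ / 2 ≤ δ) hβ.le hm₀.le hθ hq hR le_rfl hG hD hG' hD' hDG hDD hVc hVf hDV
  -- the dressed letters at rate `δ∕2` with the announced constants
  have wk : ∀ {C : ℝ}, 0 ≤ C → ∀ y y' : Tor (Mn i), C * Real.exp (-(δ * tdistT (Mn i) y y')) ≤ C * Real.exp (-(δ / 2 * (unitTorusGeoS L (kk i) (Mn i) (Msz i)).dist y y')) :=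
    fun hC y y' => mul_le_mul_of_nonneg_left (Real.exp_le_exp.mpr (neg_le_neg (by
      rw [unitTorusGeoS_dist]; nlinarith [tdistT_nonneg (Mn i) y y', hδ]))) hC
  have hGc2 := hG.mono (wk hβ.le)
  have hGf2 := hG'.mono (wk hβ.le)
  have hDG2 : HasMaj (BlockNorm.ofBlocks (unitTorusGeoS L (kk i) (Mn i) (Msz i)) (blockOf (L ^ kk i) (Mn i)))
      (BlockNorm.ofBlocks (unitTorusGeoS L (kk i) (Mn i) (Msz i)) (blockOf (L ^ kk i) (Mn i) ∘ underPtN L (kk i) (mm i) (Mn i)))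
      (idef (pull (underPtN L (kk i) (mm i) (Mn i))) (pull (underPtN L (kk i) (mm i) (Mn i)))
        (kingGOp L aS 0 (kk i + mm i) (L ^ mm i * L ^ kk i) (Mn i)) (kingGOp L aS 0 (kk i) (L ^ kk i) (Mn i)))
      (fun y y' => m₀ * ((L : ℝ) ^ kk i) ^ (-(γ / 2)) * Real.exp (-(δ / 2 * (unitTorusGeoS L (kk i) (Mn i) (Msz i)).dist y y'))) := hDG.mono (wk (mul_nonneg hm₀.le hθ))
  have hXc2 : HasMaj (BlockNorm.ofBlocks (unitTorusGeoS L (kk i) (Mn i) (Msz i)) (blockOf (L ^ kk i) (Mn i))) (BlockNorm.ofBlocks (unitTorusGeoS L (kk i) (Mn i) (Msz i)) (blockOf (L ^ kk i) (Mn i)))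
      (dressedOp (kingGOp L aS 0 (kk i) (L ^ kk i) (Mn i)) (fun μ => kingDOp L aS 0 (kk i) (L ^ kk i) (Mn i) μ) (Vc i (avg i U)))
      (fun y y' => B * Real.exp (-(δ / 2 * (unitTorusGeoS L (kk i) (Mn i) (Msz i)).dist y y'))) :=
    hXc.mono fun y y' => mul_le_mul_of_nonneg_right (by nlinarith [mul_le_mul_of_nonneg_left hinv hβ.le]) (Real.exp_nonneg _)
  have hXf2 : HasMaj (BlockNorm.ofBlocks (unitTorusGeoS L (kk i) (Mn i) (Msz i)) (blockOf (L ^ kk i) (Mn i) ∘ underPtN L (kk i) (mm i) (Mn i)))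
      (BlockNorm.ofBlocks (unitTorusGeoS L (kk i) (Mn i) (Msz i)) (blockOf (L ^ kk i) (Mn i) ∘ underPtN L (kk i) (mm i) (Mn i)))
      (dressedOp (kingGOp L aS 0 (kk i + mm i) (L ^ mm i * L ^ kk i) (Mn i)) (fun μ => kingDOp L aS 0 (kk i + mm i) (L ^ mm i * L ^ kk i) (Mn i) μ) (Vf i U))
      (fun y y' => B * Real.exp (-(δ / 2 * (unitTorusGeoS L (kk i) (Mn i) (Msz i)).dist y y'))) :=
    hXf.mono fun y y' => mul_le_mul_of_nonneg_right (by nlinarith [mul_le_mul_of_nonneg_left hinv hβ.le]) (Real.exp_nonneg _)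
  have hamp : β * (K * (Msz i * α₀) * (β * (1 - β * (K * (Msz i * α₀)) * cr)⁻¹)) * cr ≤ ε * (Msz i * α₀) := by
    have h1 : β * (K * (Msz i * α₀) * (β * (1 - β * (K * (Msz i * α₀)) * cr)⁻¹)) * cr = (β * β * K * cr * (1 - β * (K * (Msz i * α₀)) * cr)⁻¹) * (Msz i * α₀) := by ring
    rw [h1]
    refine mul_le_mul_of_nonneg_right ?_ hs0.le
    rw [hεdef]
    nlinarith [mul_le_mul_of_nonneg_left hinv (show 0 ≤ β * β * K * cr by positivity)]
  have hEc2 : HasMaj (BlockNorm.ofBlocks (unitTorusGeoS L (kk i) (Mn i) (Msz i)) (blockOf (L ^ kk i) (Mn i))) (BlockNorm.ofBlocks (unitTorusGeoS L (kk i) (Mn i) (Msz i)) (blockOf (L ^ kk i) (Mn i)))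
      (dressedOp (kingGOp L aS 0 (kk i) (L ^ kk i) (Mn i)) (fun μ => kingDOp L aS 0 (kk i) (L ^ kk i) (Mn i) μ) (Vc i (avg i U)) - kingGOp L aS 0 (kk i) (L ^ kk i) (Mn i))
      (fun y y' => ε * (Msz i * α₀) * Real.exp (-(δ / 2 * (unitTorusGeoS L (kk i) (Mn i) (Msz i)).dist y y'))) :=
    hEc.mono fun y y' => mul_le_mul_of_nonneg_right hamp (Real.exp_nonneg _)
  have hEf2 : HasMaj (BlockNorm.ofBlocks (unitTorusGeoS L (kk i) (Mn i) (Msz i)) (blockOf (L ^ kk i) (Mn i) ∘ underPtN L (kk i) (mm i) (Mn i)))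
      (BlockNorm.ofBlocks (unitTorusGeoS L (kk i) (Mn i) (Msz i)) (blockOf (L ^ kk i) (Mn i) ∘ underPtN L (kk i) (mm i) (Mn i)))
      (dressedOp (kingGOp L aS 0 (kk i + mm i) (L ^ mm i * L ^ kk i) (Mn i)) (fun μ => kingDOp L aS 0 (kk i + mm i) (L ^ mm i * L ^ kk i) (Mn i) μ) (Vf i U)
        - kingGOp L aS 0 (kk i + mm i) (L ^ mm i * L ^ kk i) (Mn i))
      (fun y y' => ε * (Msz i * α₀) * Real.exp (-(δ / 2 * (unitTorusGeoS L (kk i) (Mn i) (Msz i)).dist y y'))) :=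
    hEf.mono fun y y' => mul_le_mul_of_nonneg_right hamp (Real.exp_nonneg _)
  have hDX2 : HasMaj (BlockNorm.ofBlocks (unitTorusGeoS L (kk i) (Mn i) (Msz i)) (blockOf (L ^ kk i) (Mn i)))
      (BlockNorm.ofBlocks (unitTorusGeoS L (kk i) (Mn i) (Msz i)) (blockOf (L ^ kk i) (Mn i) ∘ underPtN L (kk i) (mm i) (Mn i)))
      (idef (pull (underPtN L (kk i) (mm i) (Mn i))) (pull (underPtN L (kk i) (mm i) (Mn i)))
        (dressedOp (kingGOp L aS 0 (kk i + mm i) (L ^ mm i * L ^ kk i) (Mn i)) (fun μ => kingDOp L aS 0 (kk i + mm i) (L ^ mm i * L ^ kk i) (Mn i) μ) (Vf i U))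
        (dressedOp (kingGOp L aS 0 (kk i) (L ^ kk i) (Mn i)) (fun μ => kingDOp L aS 0 (kk i) (L ^ kk i) (Mn i) μ) (Vc i (avg i U))))
      (fun y y' => mX * ((L : ℝ) ^ kk i) ^ (-(γ / 2)) * Real.exp (-(δ / 2 * (unitTorusGeoS L (kk i) (Mn i) (Msz i)).dist y y'))) := by
    refine hDX.mono fun y y' => ?_
    have hsub : δ - δ / 2 = δ / 2 := by ring
    rw [hsub]
    exact mul_le_mul_of_nonneg_right (mul_le_mul_of_nonneg_right ((bgConst_mono_a₀ hβ.le hcr hm₀.le hK hsa).trans_eq hmXdef.symm) hθ) (Real.exp_nonneg _)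
  -- part VI §1: the size letters and the two-grid letter of the FULL site perturbations (inner rate `δ∕2`, output rate `δ∕4`)
  have hθ' : 0 ≤ o₀ * ((L : ℝ) ^ kk i) ^ (-(γ / 2)) := mul_nonneg ho₀ hθ
  have hPc := hasMaj_sitePert365F (L := L) (Mn i) (kk i) (Msz i) (blockOf (L ^ kk i) (Mn i)) hB0 hβ.le (by positivity : 0 ≤ ε * (Msz i * α₀)) hr (half_pos hδ) hXc2 hGc2 hEc2
    hF1 hF2
  have hPf := hasMaj_sitePert365F (L := L) (Mn i) (kk i) (Msz i) (blockOf (L ^ kk i) (Mn i) ∘ underPtN L (kk i) (mm i) (Mn i)) hB0 hβ.le (by positivity : 0 ≤ ε * (Msz i * α₀)) hr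
    (half_pos hδ) hXf2 hGf2 hEf2 hF3 hF4
  have hPP := hasMaj_sitePert365F_sub (L := L) (Mn i) (kk i) (Msz i) (blockOf (L ^ kk i) (Mn i)) (underPtN L (kk i) (mm i) (Mn i)) hN hfibi hB0 hβ.le (mul_nonneg hmX0 hθ)
    (mul_nonneg hm₀.le hθ) hr hθ' (half_pos hδ) hXc2 hXf2 hDX2 hGc2 hGf2 hDG2 hF2 hF3 hF4 hF5 hF6
  have hlin := sitePertF_sizeConst_le (β := β) (ε := ε) hr₀ hs0.le hB0 hc2 hrR
  refine ⟨fun p p' => ?_, fun p p' => ?_, fun p p' => ?_⟩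
  · refine (abs_siteEntries_le_of_hasMaj (L := L) (Mn i) (kk i) (Msz i) hPc p p').trans ?_
    rw [← hc2def]
    exact mul_le_mul_of_nonneg_right hlin (Real.exp_nonneg _)
  · refine (abs_siteEntries_le_of_hasMaj (L := L) (Mn i) (kk i) (Msz i) hPf p p').trans ?_
    rw [← hc2def]
    exact mul_le_mul_of_nonneg_right hlin (Real.exp_nonneg _)
  · rw [← Matrix.sub_apply, ← siteEntries_sub]
    refine (abs_siteEntries_le_of_hasMaj (L := L) (Mn i) (kk i) (Msz i) hPP p p').trans ?_
    rw [← hc2def]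
    refine mul_le_mul_of_nonneg_right ?_ (Real.exp_nonneg _)
    exact sitePertF_fitConst_le (β := β) (m₀ := m₀) hr₀ hs0.le hB0 hc2 ho₀ hmX0 hθ hrR

end LettersF

/-! ## §2 ★★★ `NE2PlusSite` over the sized carriers, averaging species live, from the two species' sized letters alone -/

section SizedSocketF

variable (Mn : I → Fin (d + 1) → ℕ) [hMn0 : ∀ i μ, NeZero (Mn i μ)] (kk mm : I → ℕ) (Msz : I → ℝ) (X : I → Type) [∀ i, Fintype (X i)]
  (blk : ∀ i, X i → Tor (Mn i)) (gf : I → B9.Geometry) (Bc Bf : I → B9.Backgrounds)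
  (Vc : ∀ i, (Bc i).Cfg → ((Tor (fine (L ^ kk i) (Mn i)) × Option (Fin (d + 1)) → ℝ) →ₗ[ℝ] (Tor (fine (L ^ kk i) (Mn i)) → ℝ)))
  (Vf : ∀ i, (Bf i).Cfg → ((Tor (fine (L ^ mm i * L ^ kk i) (Mn i)) × Option (Fin (d + 1)) → ℝ) →ₗ[ℝ] (Tor (fine (L ^ mm i * L ^ kk i) (Mn i)) → ℝ)))
  (Fc : ∀ i, (Bc i).Cfg → (Tor (fine (L ^ kk i) (Mn i)) → ℝ) →ₗ[ℝ] (Tor (Mn i) → ℝ)) (Fsc : ∀ i, (Bc i).Cfg → (Tor (Mn i) → ℝ) →ₗ[ℝ] (Tor (fine (L ^ kk i) (Mn i)) → ℝ))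
  (Ff : ∀ i, (Bf i).Cfg → (Tor (fine (L ^ mm i * L ^ kk i) (Mn i)) → ℝ) →ₗ[ℝ] (Tor (Mn i) → ℝ))
  (Fsf : ∀ i, (Bf i).Cfg → (Tor (Mn i) → ℝ) →ₗ[ℝ] (Tor (fine (L ^ mm i * L ^ kk i) (Mn i)) → ℝ))

/-- ★★★ **`NE2PlusSite` WITH THE BACKGROUND LIVE AND THE AVERAGING SPECIES LIVE ON SIZE-LIVE CARRIERS, FROM THE TWO SPECIES' SIZED LETTERS ALONE** — part XI §1's
sized socket fed by §1 on a family `pi i = ⟨opGeo (unitTorusGeoS L (k i) (M i) (M_sz i)) (X i) (blk i), gf i, Bc i, Bf i, pair i⟩` (`gf.M = M_sz i` by the pairing's `M_eq`,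
`M_sz i ≥ 1`): the DRESSED site kernels `(Q′G′²Q′*_{L^mL^k} + P_f(U))⁻¹ − (Q′G′²Q′*_{L^k} + P_c(Ū))⁻¹` with the FULL (3.65) perturbations `P = siteEntries (sitePert365F blockOf F F* G′ X(U))`
of THE massless scalar site propagator satisfy `NE2PlusSite d′ p c₃₅` — the printed smallness `M·α₀ ≤ a₀` live, size live (so NOT the `M ≡ 1` vacuity).
[cite: Balaban1985BackgroundPropagators, Thm 3.2 (3.48) p.398 + Thm 3.14 pp.426–427 (quantifier template), (3.58) p.402, (3.63)–(3.67) pp.402–403 (mechanism); Balaban1984PropagatorsI, (1.45) p.26; King1986, Prop. 3.8 (3.71) p.664; CombesThomas1973, §II] -/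
theorem ne2PlusSite_sSiteExOn_of_sizedSpeciesLettersF (hLodd : Odd L) (hL2 : 2 ≤ L) {aS : ℝ} (haS : 0 < aS) (c35 : ℝ) (d' : ℕ) (p : ℝ) {γ : ℝ} (hγ0 : 0 < γ) (hγ1 : γ < 1)
    {mT : I → ℕ} (hMnT : ∀ i μ, Mn i μ = 2 * L ^ mT i) (hk : ∀ i, 1 ≤ kk i) (hm : ∀ i, 1 ≤ mm i) (hMsz : ∀ i, 1 ≤ Msz i)
    (pair : ∀ i, EtaPairing (opGeo (unitTorusGeoS L (kk i) (Mn i) (Msz i)) (X i) (blk i)) (gf i) (Bc i) (Bf i))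
    (hV : ∃ K a₁ : ℝ, 0 ≤ K ∧ 0 < a₁ ∧ ∀ (i : I) (α₀ : ℝ), 0 < α₀ → Msz i * α₀ ≤ a₁ → ∀ U : (Bf i).Cfg, (Bf i).Reg335 c35 α₀ U →
      HasMaj (BlockNorm.ofBlocks (unitTorusGeoS L (kk i) (Mn i) (Msz i)) (blkPair (blockOf (L ^ kk i) (Mn i))))
        (BlockNorm.ofBlocks (unitTorusGeoS L (kk i) (Mn i) (Msz i)) (blockOf (L ^ kk i) (Mn i))) (Vc i ((pair i).avg U)) (diagK fun _ => K * (Msz i * α₀)) ∧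
      HasMaj (BlockNorm.ofBlocks (unitTorusGeoS L (kk i) (Mn i) (Msz i)) (blkPair (blockOf (L ^ kk i) (Mn i) ∘ underPtN L (kk i) (mm i) (Mn i))))
        (BlockNorm.ofBlocks (unitTorusGeoS L (kk i) (Mn i) (Msz i)) (blockOf (L ^ kk i) (Mn i) ∘ underPtN L (kk i) (mm i) (Mn i))) (Vf i U) (diagK fun _ => K * (Msz i * α₀)) ∧
      HasMaj (BlockNorm.ofBlocks (unitTorusGeoS L (kk i) (Mn i) (Msz i)) (blkPair (blockOf (L ^ kk i) (Mn i))))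
        (BlockNorm.ofBlocks (unitTorusGeoS L (kk i) (Mn i) (Msz i)) (blockOf (L ^ kk i) (Mn i) ∘ underPtN L (kk i) (mm i) (Mn i)))
        (idef (pull (liftPair (underPtN L (kk i) (mm i) (Mn i)))) (pull (underPtN L (kk i) (mm i) (Mn i))) (Vf i U) (Vc i ((pair i).avg U)))
        (diagK fun _ => K * (Msz i * α₀) * ((L : ℝ) ^ kk i) ^ (-(γ / 2))))
    (hF : ∃ r₀ o₀ a₂ : ℝ, 0 ≤ r₀ ∧ 0 ≤ o₀ ∧ 0 < a₂ ∧ ∀ (i : I) (α₀ : ℝ), 0 < α₀ → Msz i * α₀ ≤ a₂ → ∀ U : (Bf i).Cfg, (Bf i).Reg335 c35 α₀ U →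
      HasMaj (BlockNorm.ofBlocks (unitTorusGeoS L (kk i) (Mn i) (Msz i)) (blockOf (L ^ kk i) (Mn i))) (BlockNorm.ofBlocks (unitTorusGeoS L (kk i) (Mn i) (Msz i)) (fun y : Tor (Mn i) => y))
        (Fc i ((pair i).avg U)) (diagK fun _ => r₀ * (Msz i * α₀)) ∧
      HasMaj (BlockNorm.ofBlocks (unitTorusGeoS L (kk i) (Mn i) (Msz i)) (fun y : Tor (Mn i) => y)) (BlockNorm.ofBlocks (unitTorusGeoS L (kk i) (Mn i) (Msz i)) (blockOf (L ^ kk i) (Mn i)))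
        (Fsc i ((pair i).avg U)) (diagK fun _ => r₀ * (Msz i * α₀)) ∧
      HasMaj (BlockNorm.ofBlocks (unitTorusGeoS L (kk i) (Mn i) (Msz i)) (blockOf (L ^ kk i) (Mn i) ∘ underPtN L (kk i) (mm i) (Mn i)))
        (BlockNorm.ofBlocks (unitTorusGeoS L (kk i) (Mn i) (Msz i)) (fun y : Tor (Mn i) => y)) (Ff i U) (diagK fun _ => r₀ * (Msz i * α₀)) ∧
      HasMaj (BlockNorm.ofBlocks (unitTorusGeoS L (kk i) (Mn i) (Msz i)) (fun y : Tor (Mn i) => y))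
        (BlockNorm.ofBlocks (unitTorusGeoS L (kk i) (Mn i) (Msz i)) (blockOf (L ^ kk i) (Mn i) ∘ underPtN L (kk i) (mm i) (Mn i))) (Fsf i U) (diagK fun _ => r₀ * (Msz i * α₀)) ∧
      HasMaj (BlockNorm.ofBlocks (unitTorusGeoS L (kk i) (Mn i) (Msz i)) (blockOf (L ^ kk i) (Mn i))) (BlockNorm.ofBlocks (unitTorusGeoS L (kk i) (Mn i) (Msz i)) (fun y : Tor (Mn i) => y))
        (idef (pull (underPtN L (kk i) (mm i) (Mn i))) LinearMap.id (Ff i U) (Fc i ((pair i).avg U))) (diagK fun _ => o₀ * ((L : ℝ) ^ kk i) ^ (-(γ / 2))) ∧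
      HasMaj (BlockNorm.ofBlocks (unitTorusGeoS L (kk i) (Mn i) (Msz i)) (fun y : Tor (Mn i) => y))
        (BlockNorm.ofBlocks (unitTorusGeoS L (kk i) (Mn i) (Msz i)) (blockOf (L ^ kk i) (Mn i) ∘ underPtN L (kk i) (mm i) (Mn i)))
        (idef LinearMap.id (pull (underPtN L (kk i) (mm i) (Mn i))) (Fsf i U) (Fsc i ((pair i).avg U))) (diagK fun _ => o₀ * ((L : ℝ) ^ kk i) ^ (-(γ / 2)))) :
    NE2PlusSite d' p c35 (fun i => (⟨opGeo (unitTorusGeoS L (kk i) (Mn i) (Msz i)) (X i) (blk i), gf i, Bc i, Bf i, pair i⟩ : PairedInstance))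
      (sSiteExOn Mn kk mm Msz X blk gf Bc Bf aS pair
        (fun i U => siteEntries (Mn i) (sitePert365F (Mn i) (blockOf (L ^ kk i) (Mn i) ∘ underPtN L (kk i) (mm i) (Mn i)) (Ff i U) (Fsf i U)
          (kingGOp L aS 0 (kk i + mm i) (L ^ mm i * L ^ kk i) (Mn i))
          (dressedOp (kingGOp L aS 0 (kk i + mm i) (L ^ mm i * L ^ kk i) (Mn i)) (fun μ => kingDOp L aS 0 (kk i + mm i) (L ^ mm i * L ^ kk i) (Mn i) μ) (Vf i U))))
        (fun i V => siteEntries (Mn i) (sitePert365F (Mn i) (blockOf (L ^ kk i) (Mn i)) (Fc i V) (Fsc i V) (kingGOp L aS 0 (kk i) (L ^ kk i) (Mn i))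
          (dressedOp (kingGOp L aS 0 (kk i) (L ^ kk i) (Mn i)) (fun μ => kingDOp L aS 0 (kk i) (L ^ kk i) (Mn i) μ) (Vc i V))))) := by
  have hgM : ∀ i, (gf i).M = Msz i := fun i => (pair i).M_eq
  have hM : ∀ i, 1 ≤ (gf i).M := fun i => (hgM i).symm ▸ hMsz i
  obtain ⟨δP, ζ, τ, a₁, hδP, hζ, hτ, ha₁, HP⟩ :=
    siteLettersF_of_sizedSpeciesLetters (L := L) Mn kk mm Msz Bc Bf (fun i => (pair i).avg) Vc Vf Fc Fsc Ff Fsf hLodd hL2 haS c35 hγ0 hγ1 hMnT hk hm hMsz hV hF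
  refine ne2PlusSite_sSiteExOn_of_sizedLetters Mn kk mm Msz X blk gf Bc Bf hLodd hL2 haS c35 d' p hMnT hk hM pair _ _ (half_pos hγ0)
    ⟨δP, ζ, τ, a₁, hδP, hζ, hτ, ha₁, fun i α₀ hα₀ hMα U hreg => ?_⟩
  rw [hgM i] at hMα ⊢
  exact HP i α₀ hα₀ hMα U hreg

end SizedSocketF

end Summit.QuantumFields.YangMills.BalabanUVNodes.N15.SiteLayerBg

end
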